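import Summits.Ventures.CertifiedManyBodySolver.Observables.SourcedOrderParameterFloorTTPrime
import Summits.HubbardSuperconductivity.HubbardLadder.Bounds.LUCUpperBoundsTI3
import Literature.MathematicalPhysics.QuantumLattice.HubbardNNNHoppingTorusLimitCorrelator
import Literature.MathematicalPhysics.QuantumLattice.HubbardModelParticleHoleProofs
import Literature.MathematicalPhysics.QuantumLattice.FinDimSpectrumProofs
import HarnessLib

/-!
# F-B′ inputs at diagonal hopping `t'`: a certified CANONICAL thermodynamic-limit upper row
# `e(1,t',U,n) ≤ hi` caps the source-free grand-canonical energy (Legendre), so the `t–t'` order-parameter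
# ceiling needs only that row and ONE sourced LOWER row — with the `(8, 7/8, −1/4)` row of record BY NAME

HONEST FRAMING: first certified bounds on pairing observables; not a superconductivity verdict; a CEILING on the
Koma–Tasaki order parameter says nothing about the presence of pairing; every number certified or labelled float;
nothing is instantiated beyond naming an existing typed row as a HYPOTHESIS. Cell hubbard-cq (LADDER rung CQ at
`(U, δ, t') = (8, 1/8, −1/4)`), seat hubbard-cq-obsth-3; the `t'`-twin of `SourcedOrderParameterCeilingInputs.lean`
(hubbard-obs-p1, `t' = 0`), on the objects `dWaveSourceTorusTT'` (obsth-1), `dWaveOrderParameterTT'` (lit-2) and the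
ceiling `dWaveOrderParameterTT'_le_of_sourced_energy_window` (`SourcedOrderParameterFloorTTPrime.lean`, this seat).

* `groundEnergy_hubbardTorusTT'_sub_mu_le_sector` — Legendre on the finite torus:
  `E₀(H_L(1,t',U) − μN) ≤ E_{rectN n L}^{t'}(L) − μ·rectN n L` (Rayleigh quotient of a unit sector ground state).
* `eventually_groundEnergy_dWaveSourceTorusTT'_zero_le` — its thermodynamic limit: for `U ≥ 0`, `0 ≤ n < 2`, every
  `μ` and every `u₀ > e(1,t',U,n) − μn`, eventually `E₀(dWaveSourceTorusTT' (L+1) t' U μ 0) ≤ u₀ (L+1)²`.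
* `dWaveOrderParameterTT'_le_of_canonical_upper_of_sourced_lower` — THE FED CEILING: a TL upper row
  `energyDensityTT' 1 t' U n ≤ hi`, any `μ`, `0 < h < H`, and an eventual sourced lower row
  `ℓ (L+1)² ≤ E₀(dWaveSourceTorusTT' (L+1) t' U μ H)` give `dWaveOrderParameterTT' t' U μ ≤ (hi − μn − ℓ)/(2(H − h))`;
  letting `h ↓ 0`, `≤ (hi − μn − ℓ)/(2H)` (`…_of_sourced_lower'`).
* `dWaveOrderParameterTT'_tpm1o4_U8_le_of_tlUpperTI_of_sourced_lower` — the `(8, 7/8, −1/4)` instance with the TL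
  upper row of record `Bounds.tlUpperTI_U8_tpm1o4_n7o8_16k_ti4ds` (`e(1,−1/4,8,7/8) ≤ −355026702567/2³⁹`, pub-hubbard
  V-TI11 = mbsolver CERTIFIED #93 upper) BY NAME as a hypothesis, and ONE sourced lower certificate row at field `H`
  (the pinning-field menu's product, `hubbard-cq-pilot-2`; hypothesis-shaped): `m*_d(−1/4, 8, μ) ≤
  (−355026702567/2³⁹ − (7/8)μ − ℓ)/(2H)`. A tighter typed upper row (e.g. an open-box MPS row) plugs into the
  generic theorem verbatim.

References: T. Koma, H. Tasaki, J. Stat. Phys. 76 (1994) 745, §1; H. Tasaki (2020) §2.1 (variational principle);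
D. Ruelle (1969) §3.3–3.4; H. Xu et al., Science 384 (2024) eadh7691, eq. (1) and §III.B.
-/

noncomputable section

namespace Summit.Ventures.CertifiedManyBodySolver.Observables

open Matrix Literature.MathematicalPhysics.QuantumLattice Literature.Probability.LatticeModels
open Literature.MathematicalPhysics.QuantumLattice.HubbardWave0 ThermodynamicLimit Filter Topology
open scoped BigOperators ComplexOrder

/-- **Legendre inequality on a finite torus at `t'`**: the grand-canonical ground energy of `H_L(1,t',U) − μN̂` is
at most the canonical sector ground energy at density `n` minus `μ · rectN n L`, for every `0 ≤ n ≤ 2` (Rayleigh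
quotient of a unit ground state of the sector `(rectN n L, S^z = 0)`). Tasaki (2020) §2.1. -/
theorem groundEnergy_hubbardTorusTT'_sub_mu_le_sector (L : ℕ) [NeZero L] (t' U μ : ℝ) {n : ℝ} (hn0 : 0 ≤ n)
    (hn2 : n ≤ 2) :
    (hubbardTorusTT' L 1 t' U - (μ : ℂ) • totalNumber).groundEnergy ≤
      groundEnergy (hubbardTorusTT' L 1 t' U) (rectN n L) - μ * (rectN n L : ℝ) := by
  obtain ⟨ψ, hψ, h1⟩ := exists_unit_isGroundStateInSector_hubbardTorusTT' L 1 t' U hn0 hn2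
  have hray := Matrix.groundEnergy_le_rayleigh_holds (isHermitian_hubbardTorusTT'_sub_smul_totalNumber L t' U μ) ψ h1
  have hN : IsNParticle (rectN n L) ψ := ((mem_szSector_iff _ _ _).1 hψ.1).1
  have hE := re_rayleigh_hubbardTorusTT'_of_isGroundStateInSector_rectN L 1 t' U hn0 hn2 hψ h1
  have hsplit : (star ψ ⬝ᵥ ((hubbardTorusTT' L 1 t' U - (μ : ℂ) • totalNumber) *ᵥ ψ)).re =
      (star ψ ⬝ᵥ (hubbardTorusTT' L 1 t' U *ᵥ ψ)).re - μ * (rectN n L : ℝ) := by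
    rw [sub_mulVec, smul_mulVec, totalNumber_mulVec_of_isNParticle hN, dotProduct_sub, dotProduct_smul,
      dotProduct_smul, h1, Complex.sub_re, smul_eq_mul, smul_eq_mul, mul_one]
    simp
  rw [hsplit, hE] at hray
  exact hray

/-- **Thermodynamic limit of the Legendre inequality at `t'`**: for `U ≥ 0`, `0 ≤ n < 2`, every `μ` and every
`u₀ > energyDensityTT' 1 t' U n − μ n`, the source-free grand-canonical torus ground energies eventually satisfy
`E₀(dWaveSourceTorusTT' (L+1) t' U μ 0) ≤ u₀ (L+1)²`. Ruelle (1969) §3.4; Tasaki (2020) §2.1. -/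
theorem eventually_groundEnergy_dWaveSourceTorusTT'_zero_le (t' : ℝ) {U : ℝ} (hU : 0 ≤ U) (μ : ℝ) {n : ℝ}
    (hn0 : 0 ≤ n) (hn2 : n < 2) {u₀ : ℝ} (hu₀ : energyDensityTT' 1 t' U n - μ * n < u₀) :
    ∀ᶠ L : ℕ in atTop, (dWaveSourceTorusTT' (L + 1) t' U μ 0).groundEnergy ≤ u₀ * (((L + 1 : ℕ) : ℝ)) ^ 2 := by
  have hE : Tendsto (fun L : ℕ => groundEnergy (hubbardTorusTT' (L + 1) 1 t' U) (rectN n (L + 1)) /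
      (((L + 1 : ℕ) : ℝ)) ^ 2) atTop (𝓝 (energyDensityTT' 1 t' U n)) :=
    (tendsto_energyDensityTT'_torus 1 t' hU hn0 hn2).comp (tendsto_add_atTop_nat 1)
  have hN : Tendsto (fun L : ℕ => (rectN n (L + 1) : ℝ) / (((L + 1 : ℕ) : ℝ)) ^ 2) atTop (𝓝 n) :=
    (tendsto_rectN_div_sq hn0).comp (tendsto_add_atTop_nat 1)
  have hlim : Tendsto (fun L : ℕ => groundEnergy (hubbardTorusTT' (L + 1) 1 t' U) (rectN n (L + 1)) /
      (((L + 1 : ℕ) : ℝ)) ^ 2 - μ * ((rectN n (L + 1) : ℝ) / (((L + 1 : ℕ) : ℝ)) ^ 2)) atTop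
      (𝓝 (energyDensityTT' 1 t' U n - μ * n)) := hE.sub (hN.const_mul μ)
  filter_upwards [hlim.eventually (gt_mem_nhds hu₀)] with L hL
  have hpos : (0 : ℝ) < (((L + 1 : ℕ) : ℝ)) ^ 2 := by positivity
  have hfin := groundEnergy_hubbardTorusTT'_sub_mu_le_sector (L + 1) t' U μ hn0 hn2.le
  rw [dWaveSourceTorusTT'_zero_source]
  have hdiv : groundEnergy (hubbardTorusTT' (L + 1) 1 t' U) (rectN n (L + 1)) - μ * (rectN n (L + 1) : ℝ) ≤
      u₀ * (((L + 1 : ℕ) : ℝ)) ^ 2 := by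
    have h' : (groundEnergy (hubbardTorusTT' (L + 1) 1 t' U) (rectN n (L + 1)) - μ * (rectN n (L + 1) : ℝ)) /
        (((L + 1 : ℕ) : ℝ)) ^ 2 < u₀ := by
      rw [sub_div, mul_div_assoc]
      exact hL
    exact ((div_lt_iff₀ hpos).1 h').le
  exact hfin.trans hdiv

/-- **F-B′ at `t'` in the form the cell can feed.** For `U ≥ 0`, any density `0 ≤ n < 2` with a certified
thermodynamic-limit UPPER row `energyDensityTT' 1 t' U n ≤ hi`, any chemical potential `μ`, sources `0 < h < H`, and an
eventual certified LOWER row `ℓ (L+1)² ≤ E₀(dWaveSourceTorusTT' (L+1) t' U μ H)` for the SOURCED grand-canonical torus: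
`dWaveOrderParameterTT' t' U μ ≤ (hi − μ n − ℓ)/(2(H − h))`. Koma–Tasaki 1994 §1. -/
theorem dWaveOrderParameterTT'_le_of_canonical_upper_of_sourced_lower (t' : ℝ) {U : ℝ} (hU : 0 ≤ U) (μ : ℝ)
    {n : ℝ} (hn0 : 0 ≤ n) (hn2 : n < 2) {hi : ℝ} (hhi : energyDensityTT' 1 t' U n ≤ hi) {h H ℓ : ℝ} (hh : 0 < h)
    (hhH : h < H)
    (hl : ∀ᶠ L : ℕ in atTop, ℓ * (((L + 1 : ℕ) : ℝ)) ^ 2 ≤ (dWaveSourceTorusTT' (L + 1) t' U μ H).groundEnergy) :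
    dWaveOrderParameterTT' t' U μ ≤ (hi - μ * n - ℓ) / (2 * (H - h)) := by
  have hHh : 0 < 2 * (H - h) := by linarith
  refine le_of_forall_pos_le_add fun ε hε => ?_
  have hu₀ : energyDensityTT' 1 t' U n - μ * n < hi - μ * n + ε * (2 * (H - h)) := by
    have hprod := mul_pos hε hHh
    linarith
  have hu := eventually_groundEnergy_dWaveSourceTorusTT'_zero_le t' hU μ hn0 hn2 hu₀
  have hceil := dWaveOrderParameterTT'_le_of_sourced_energy_window t' U μ hh hhH hu hl
  have heq : (hi - μ * n + ε * (2 * (H - h)) - ℓ) / (2 * (H - h)) = (hi - μ * n - ℓ) / (2 * (H - h)) + ε := by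
    rw [show hi - μ * n + ε * (2 * (H - h)) - ℓ = (hi - μ * n - ℓ) + ε * (2 * (H - h)) by ring, add_div,
      mul_div_cancel_right₀ ε hHh.ne']
  rw [heq] at hceil
  exact hceil

/-- **The same ceiling with `h ↓ 0` taken**: under the hypotheses above (the smaller source `h` is free),
`dWaveOrderParameterTT' t' U μ ≤ (hi − μ n − ℓ)/(2H)` whenever `ℓ ≤ hi − μn` (the non-vacuous case; otherwise the
order parameter, being `≥ 0`, is trivially below any bound this family can give at small `h`). Koma–Tasaki 1994 §1. -/
theorem dWaveOrderParameterTT'_le_of_canonical_upper_of_sourced_lower' (t' : ℝ) {U : ℝ} (hU : 0 ≤ U) (μ : ℝ)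
    {n : ℝ} (hn0 : 0 ≤ n) (hn2 : n < 2) {hi : ℝ} (hhi : energyDensityTT' 1 t' U n ≤ hi) {H ℓ : ℝ} (hH : 0 < H)
    (hs : ℓ ≤ hi - μ * n)
    (hl : ∀ᶠ L : ℕ in atTop, ℓ * (((L + 1 : ℕ) : ℝ)) ^ 2 ≤ (dWaveSourceTorusTT' (L + 1) t' U μ H).groundEnergy) :
    dWaveOrderParameterTT' t' U μ ≤ (hi - μ * n - ℓ) / (2 * H) := by
  -- the bound `(hi − μn − ℓ)/(2(H − h))` tends to `(hi − μn − ℓ)/(2H)` as `h ↓ 0`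
  refine le_of_forall_pos_le_add fun ε hε => ?_
  set s := hi - μ * n - ℓ with hs_def
  have hs0 : 0 ≤ s := by rw [hs_def]; linarith
  -- choose `h ∈ (0, H)` with `s/(2(H−h)) ≤ s/(2H) + ε`: any `h ≤ H/2` small enough; take `h` with `s·h ≤ 2ε H (H−h)`
  -- concretely `h := min (H/2) (ε H² /(s + 1))`
  set h := min (H / 2) (ε * H ^ 2 / (s + 1)) with hh_def
  have hhpos : 0 < h := by
    rw [hh_def]
    refine lt_min (by linarith) ?_
    positivity
  have hhH2 : h ≤ H / 2 := min_le_left _ _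
  have hhε : h ≤ ε * H ^ 2 / (s + 1) := min_le_right _ _
  have hhH : h < H := by linarith
  have key := dWaveOrderParameterTT'_le_of_canonical_upper_of_sourced_lower t' hU μ hn0 hn2 hhi hhpos hhH hl
  -- compare `s/(2(H−h))` with `s/(2H) + ε`
  have hHh : 0 < H - h := by linarith
  have hcmp : s / (2 * (H - h)) ≤ s / (2 * H) + ε := by
    rw [div_le_iff₀ (by positivity)]
    -- need: s ≤ (s/(2H) + ε)·2(H−h) = s(H−h)/H + 2ε(H−h), i.e. s h / H ≤ 2ε(H−h); since H−h ≥ H/2, enough s h ≤ ε H²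
    have h1 : s * h ≤ ε * H ^ 2 := by
      have := mul_le_mul_of_nonneg_left hhε hs0
      have h2 : s * (ε * H ^ 2 / (s + 1)) ≤ ε * H ^ 2 := by
        rw [mul_div_assoc']
        rw [div_le_iff₀ (by linarith)]
        nlinarith [mul_nonneg hε.le (sq_nonneg H)]
      exact this.trans h2
    have hH0 : H ≠ 0 := hH.ne'
    have e1 : (s / (2 * H) + ε) * (2 * (H - h)) = s * (H - h) / H + 2 * ε * (H - h) := by
      field_simp
    rw [e1]
    have h3 : s * (H - h) / H = s - s * h / H := by
      field_simp
    rw [h3]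
    have h4 : s * h / H ≤ ε * H := by
      rw [div_le_iff₀ hH]
      nlinarith [h1]
    nlinarith [h4, hHh, hε]
  exact key.trans hcmp

/-- **The `(U, n, t') = (8, 7/8, −1/4)` instance, fed by the TL upper row of record BY NAME.** Hypotheses: the
typed row `Bounds.tlUpperTI_U8_tpm1o4_n7o8_16k_ti4ds` (`e(1,−1/4,8,7/8) ≤ −355026702567/2³⁹`; pub-hubbard V-TI11,
mbsolver CERTIFIED #93 upper), ANY chemical potential `μ`, a field `H > 0`, and ONE sourced LOWER certificate row
`∃ L₀, ∀ L ≥ L₀, ℓ·L² ≤ E₀(dWaveSourceTorusTT' L (−1/4) 8 μ H)` (the conclusion shape of a gauge-broken window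
certificate; no instance is claimed) with `ℓ ≤ −355026702567/2³⁹ − (7/8)μ`. Conclusion: the Koma–Tasaki `d`-wave
order parameter of the `t' = −1/4` Hubbard model obeys `m*_d(−1/4, 8, μ) ≤ (−355026702567/2³⁹ − (7/8)μ − ℓ)/(2H)`.
Koma–Tasaki 1994 §1. -/
theorem dWaveOrderParameterTT'_tpm1o4_U8_le_of_tlUpperTI_of_sourced_lower
    (hrow : Summit.HubbardSuperconductivity.HubbardLadder.Bounds.tlUpperTI_U8_tpm1o4_n7o8_16k_ti4ds) (μ : ℝ)
    {H ℓ : ℝ} (hH : 0 < H) (hs : ℓ ≤ (-355026702567 : ℝ) / 2 ^ 39 - μ * (7 / 8))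
    (hl : ∃ L₀ : ℕ, ∀ (L : ℕ) [NeZero L], L₀ ≤ L →
      ℓ * (L : ℝ) ^ 2 ≤ (dWaveSourceTorusTT' L ((-1 : ℝ) / 4) 8 μ H).groundEnergy) :
    dWaveOrderParameterTT' ((-1 : ℝ) / 4) 8 μ ≤ ((-355026702567 : ℝ) / 2 ^ 39 - μ * (7 / 8) - ℓ) / (2 * H) := by
  obtain ⟨L₀, hL₀⟩ := hl
  refine dWaveOrderParameterTT'_le_of_canonical_upper_of_sourced_lower' ((-1 : ℝ) / 4) (U := 8) (by norm_num) μ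
    (n := 7 / 8) (by norm_num) (by norm_num) hrow hH hs ?_
  filter_upwards [eventually_ge_atTop L₀] with L hL
  exact hL₀ (L + 1) (hL.trans (Nat.le_succ L))

end Summit.Ventures.CertifiedManyBodySolver.Observables

end
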